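import Literature.Analysis.PDE.NewtonianPotentialRegularity
import Literature.Analysis.PDE.PoissonBall
import Mathlib.Analysis.Calculus.BumpFunction.InnerProduct
import HarnessLib

/-!
# Mild solutions of the Loewner–Nirenberg equation are classical

Analysis/PDE support file (definitions with bodies and PROVED theorems only; no named facts) on
the discharge path of `Literature.Analysis.PDE.LoewnerNirenberg.exists_isMaximalSolution`
(the maximal solution of `Δu = f_n(u) = ¼n(n-2)u^{(n+2)/(n-2)}` by Perron's method,
`LoewnerNirenbergPerron.lean`).  Both analytic inputs of Perron's method — the local solver on
small balls (a fixed point of `z = P[φ] + N[χ f(z)] - P[N[χ f(z)]]`) and the compactness of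
bounded monotone sequences of solutions (a limit of Poisson–Newton representations) — deliver a
positive continuous function `z` which is, near every point, a HARMONIC FUNCTION PLUS THE
NEWTONIAN POTENTIAL OF A BOUNDED DENSITY EQUAL TO `f_n(z)` NEARBY.  We call such `z` MILD
(`LoewnerNirenberg.IsMild`) and prove that mild functions are classical solutions
(`IsMild.isSolution`), by the bootstrap of Gilbarg–Trudinger §4.1–4.2 with the Newtonian
potential lemmas N1–N4 of `NewtonianPotential*.lean`:

* localisation (`IsMild.exists_local`): with a bump `θ` (`= 1` near `x₀`, supported where the
  representation holds) the density splits as `θ f(z) + (g - θ f(z))`; the potential of the second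
  part is harmonic near `x₀` (N4), so `z = H + N[θ f(z)]` near `x₀` with `H` harmonic;
* `z ∈ C¹` (N1: potentials of bounded densities are `C¹`; `IsMild.contDiffOn_one`), hence
  `θ f(z) ∈ C¹_c`, hence `N[θ f(z)] ∈ C²` (N3) and `z ∈ C²` (`IsMild.contDiffOn_two`), hence
  `θ f(z) ∈ C²_c` and `Δ N[θ f(z)] = θ f(z)` (N2), i.e. `Δz = f(z)` (`IsMild.isSolution`).

Also here, for the compactness step: the Poisson–Newton REPRESENTATION of a classical solution
on inner balls (`IsSolution.sub_potential_eq_poisson`: `z - N[θ f(z)] = P_ρ[z - N[θ f(z)]]` on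
`B̄(c, ρ)` when `θ = 1` on `B̄(c, ρ)`), and the elementary continuity of `N` and `P_ρ` under
uniform convergence of densities and data (`abs_potential_sub_potential_le`,
`abs_poisson_sub_poisson_le`).

## References

* D. Gilbarg, N. S. Trudinger, *Elliptic Partial Differential Equations of Second Order*
  (Springer 2001), §2.5 Thm. 2.6, §2.8, §4.1 Lemmas 4.1–4.2. [GilbargTrudinger2001]
* M. d. M. González, Y. Y. Li, L. Nguyen, *Existence and uniqueness to a fully nonlinear version
  of the Loewner–Nirenberg problem*, Commun. Math. Stat. 6 (2018) 269–288, arXiv:1804.08851,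
  proof of Thm. 1.1. [GonzalezLiNguyen2018]
-/

noncomputable section

open Set Filter Metric Module TopologicalSpace MeasureTheory Function
open scoped Laplacian Topology ContDiff

namespace Literature.Analysis.PDE

namespace LoewnerNirenberg

open Newtonian PoissonBall

variable {E : Type*} [NormedAddCommGroup E] [InnerProductSpace ℝ E] [FiniteDimensional ℝ E]
  [MeasurableSpace E] [BorelSpace E]

/-! ### Smoothness helpers -/

omit [FiniteDimensional ℝ E] [MeasurableSpace E] [BorelSpace E] in
/-- A function which is `C^m` on an open set containing its topological support is `C^m`.
[folklore] -/
theorem contDiff_of_contDiffOn_of_tsupport_subset {f : E → ℝ} {U : Set E}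
    {m : WithTop ℕ∞} (hU : IsOpen U) (hf : ContDiffOn ℝ m f U) (hts : tsupport f ⊆ U) :
    ContDiff ℝ m f := by
  refine contDiff_iff_contDiffAt.2 fun x => ?_
  by_cases hx : x ∈ U
  · exact hf.contDiffAt (hU.mem_nhds hx)
  · have h0 : f =ᶠ[𝓝 x] 0 := notMem_tsupport_iff_eventuallyEq.1 fun h => hx (hts h)
    exact (contDiffAt_const (c := (0 : ℝ))).congr_of_eventuallyEq h0

omit [FiniteDimensional ℝ E] [MeasurableSpace E] [BorelSpace E] in
/-- The nonlinearity `f_n(z) = ¼n(n-2) z^{(n+2)/(n-2)}` of a positive `C^m` function is `C^m`.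
[folklore] -/
theorem contDiffOn_nonlinearity_comp {m : WithTop ℕ∞} {U : Set E} {z : E → ℝ}
    (hz : ContDiffOn ℝ m z U) (hpos : ∀ x ∈ U, 0 < z x) :
    ContDiffOn ℝ m (fun x => nonlinearity (finrank ℝ E) (z x)) U := by
  unfold nonlinearity
  exact contDiffOn_const.mul (hz.rpow_const_of_ne fun x hx => (hpos x hx).ne')

omit [FiniteDimensional ℝ E] [MeasurableSpace E] [BorelSpace E] in
/-- The nonlinearity of a continuous function is continuous (`n ≥ 3`). [folklore] -/
theorem continuousOn_nonlinearity_comp (hn : 3 ≤ finrank ℝ E) {U : Set E} {z : E → ℝ}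
    (hz : ContinuousOn z U) : ContinuousOn (fun x => nonlinearity (finrank ℝ E) (z x)) U := by
  unfold nonlinearity
  exact continuousOn_const.mul (hz.rpow_const fun x _ => Or.inr (exponent_pos hn).le)

/-- The nonlinearity is monotone on `[0, ∞)` (`n ≥ 3`). [folklore] -/
theorem nonlinearity_le_nonlinearity {n : ℕ} (hn : 3 ≤ n) {s t : ℝ} (hs : 0 ≤ s) (hst : s ≤ t) :
    nonlinearity n s ≤ nonlinearity n t := by
  rcases hst.lt_or_eq with h | h
  · exact (nonlinearity_lt_nonlinearity hn hs h).le
  · rw [h]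

/-- Bound of the nonlinearity of a function with values in `[0, M]`: `|f_n(z y)| ≤ f_n(M)`.
[folklore] -/
theorem abs_nonlinearity_le {n : ℕ} (hn : 3 ≤ n) {t M : ℝ} (h0 : 0 ≤ t) (hM : t ≤ M) :
    |nonlinearity n t| ≤ nonlinearity n M := by
  rw [abs_of_nonneg (nonlinearity_nonneg (by omega) h0)]
  exact nonlinearity_le_nonlinearity hn h0 hM

/-! ### Bump-localised densities `θ · f_n(z)` -/

section Density

variable {z : E → ℝ} {x₀ : E}

/-- The LOCALISED DENSITY `θ · f_n(z)` of a bump `θ` centred at `x₀`. [folklore] -/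
def bumpDensity (θ : ContDiffBump x₀) (z : E → ℝ) (y : E) : ℝ :=
  θ y * nonlinearity (finrank ℝ E) (z y)

omit [MeasurableSpace E] [BorelSpace E] in
/-- The localised density has support in `B̄(x₀, r_out)`. [folklore] -/
theorem tsupport_bumpDensity_subset (θ : ContDiffBump x₀) (z : E → ℝ) :
    tsupport (bumpDensity θ z) ⊆ closedBall x₀ θ.rOut := by
  rw [← θ.tsupport_eq]
  exact tsupport_mul_subset_left

omit [MeasurableSpace E] [BorelSpace E] in
/-- The localised density vanishes off `B(x₀, s)` once `r_out < s`. [folklore] -/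
theorem bumpDensity_eq_zero (θ : ContDiffBump x₀) (z : E → ℝ) {s : ℝ} (hs : θ.rOut < s) :
    ∀ y ∉ ball x₀ s, bumpDensity θ z y = 0 := fun _ hy =>
  image_eq_zero_of_notMem_tsupport fun h =>
    hy (closedBall_subset_ball hs (tsupport_bumpDensity_subset θ z h))

omit [MeasurableSpace E] [BorelSpace E] in
/-- On `B̄(x₀, r_in)` the localised density is `f_n(z)`. [folklore] -/
theorem bumpDensity_eq_of_mem (θ : ContDiffBump x₀) (z : E → ℝ) {y : E}
    (hy : y ∈ closedBall x₀ θ.rIn) : bumpDensity θ z y = nonlinearity (finrank ℝ E) (z y) := by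
  rw [bumpDensity, θ.one_of_mem_closedBall hy, one_mul]

omit [MeasurableSpace E] [BorelSpace E] in
/-- Bound: `|θ f_n(z)| ≤ f_n(M)` if `0 ≤ z ≤ M` on `B(x₀, s)`, `r_out < s` (`n ≥ 3`). [folklore] -/
theorem abs_bumpDensity_le (hn : 3 ≤ finrank ℝ E) (θ : ContDiffBump x₀) {s M : ℝ}
    (hs : θ.rOut < s) (h0 : ∀ y ∈ ball x₀ s, 0 ≤ z y) (hM : ∀ y ∈ ball x₀ s, z y ≤ M) (y : E) :
    |bumpDensity θ z y| ≤ nonlinearity (finrank ℝ E) M := by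
  by_cases hy : y ∈ ball x₀ s
  · rw [bumpDensity, abs_mul, abs_of_nonneg θ.nonneg]
    calc θ y * |nonlinearity (finrank ℝ E) (z y)| ≤ 1 * nonlinearity (finrank ℝ E) M :=
          mul_le_mul θ.le_one (abs_nonlinearity_le hn (h0 y hy) (hM y hy)) (abs_nonneg _)
            zero_le_one
      _ = _ := one_mul _
  · rw [bumpDensity_eq_zero θ z hs y hy, abs_zero]
    have hM0 : 0 ≤ M := by
      have hx₀ : x₀ ∈ ball x₀ s := mem_ball_self (θ.rOut_pos.trans hs)
      exact (h0 x₀ hx₀).trans (hM x₀ hx₀)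
    exact nonlinearity_nonneg (by omega) hM0

omit [MeasurableSpace E] [BorelSpace E] in
/-- Smoothness: `θ f_n(z) ∈ C^m(E)` if `z` is positive and `C^m` on an open `U ⊇ B̄(x₀, r_out)`.
[folklore] -/
theorem contDiff_bumpDensity {m : ℕ∞} (θ : ContDiffBump x₀) {U : Set E} (hU : IsOpen U)
    (hsub : closedBall x₀ θ.rOut ⊆ U) (hz : ContDiffOn ℝ m z U) (hpos : ∀ x ∈ U, 0 < z x) :
    ContDiff ℝ m (bumpDensity θ z) :=
  contDiff_of_contDiffOn_of_tsupport_subset hU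
    (((θ.contDiff (n := m)).contDiffOn).mul (contDiffOn_nonlinearity_comp hz hpos))
    ((tsupport_bumpDensity_subset θ z).trans hsub)

omit [MeasurableSpace E] [BorelSpace E] in
/-- Continuity: `θ f_n(z)` is continuous if `z` is continuous on an open `U ⊇ B̄(x₀, r_out)`
(`n ≥ 3`). [folklore] -/
theorem continuous_bumpDensity (hn : 3 ≤ finrank ℝ E) (θ : ContDiffBump x₀) {U : Set E}
    (hU : IsOpen U) (hsub : closedBall x₀ θ.rOut ⊆ U) (hz : ContinuousOn z U) :
    Continuous (bumpDensity θ z) := by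
  refine continuous_iff_continuousAt.2 fun x => ?_
  by_cases hx : x ∈ U
  · exact ((θ.continuous.continuousOn).mul
      (continuousOn_nonlinearity_comp hn hz)).continuousAt (hU.mem_nhds hx)
  · have h0 : bumpDensity θ z =ᶠ[𝓝 x] 0 := notMem_tsupport_iff_eventuallyEq.1 fun h' =>
      hx (hsub (tsupport_bumpDensity_subset θ z h'))
    exact (continuousAt_congr h0).2 continuousAt_const

/-- Integrability: `θ f_n(z)` is integrable if `z` is continuous on an open `U ⊇ B̄(x₀, r_out)`
(`n ≥ 3`; continuous with compact support). [folklore] -/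
theorem integrable_bumpDensity (hn : 3 ≤ finrank ℝ E) (θ : ContDiffBump x₀) {U : Set E}
    (hU : IsOpen U) (hsub : closedBall x₀ θ.rOut ⊆ U) (hz : ContinuousOn z U) :
    Integrable (bumpDensity θ z) :=
  (continuous_bumpDensity hn θ hU hsub hz).integrable_of_hasCompactSupport
    (HasCompactSupport.of_support_subset_isCompact (isCompact_closedBall x₀ θ.rOut)
      (subset_tsupport _ |>.trans (tsupport_bumpDensity_subset θ z)))

end Density

/-! ### Linearity of the Newtonian potential on bounded densities -/

section Linearity

variable {g₁ g₂ : E → ℝ} {c : E} {R M₁ M₂ : ℝ}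

/-- `N (g₁ + g₂) = N g₁ + N g₂` for bounded integrable densities supported in a common ball
(`n ≥ 3`). [folklore] -/
theorem potential_add (hn : 3 ≤ finrank ℝ E) (h₁ : Integrable g₁) (hM₁ : ∀ z, |g₁ z| ≤ M₁)
    (hs₁ : ∀ z ∉ ball c R, g₁ z = 0) (h₂ : Integrable g₂) (hM₂ : ∀ z, |g₂ z| ≤ M₂)
    (hs₂ : ∀ z ∉ ball c R, g₂ z = 0) (x : E) :
    potential 0 (fun z => g₁ z + g₂ z) x = potential 0 g₁ x + potential 0 g₂ x := by
  unfold potential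
  rw [← integral_add (integrable_mul_kernel hn le_rfl h₁ hM₁ hs₁ x)
    (integrable_mul_kernel hn le_rfl h₂ hM₂ hs₂ x)]
  refine integral_congr_ae (Eventually.of_forall fun z => ?_)
  simp only [add_mul]

/-- `N (g₁ - g₂) = N g₁ - N g₂` for bounded integrable densities supported in a common ball
(`n ≥ 3`). [folklore] -/
theorem potential_sub (hn : 3 ≤ finrank ℝ E) (h₁ : Integrable g₁) (hM₁ : ∀ z, |g₁ z| ≤ M₁)
    (hs₁ : ∀ z ∉ ball c R, g₁ z = 0) (h₂ : Integrable g₂) (hM₂ : ∀ z, |g₂ z| ≤ M₂)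
    (hs₂ : ∀ z ∉ ball c R, g₂ z = 0) (x : E) :
    potential 0 (fun z => g₁ z - g₂ z) x = potential 0 g₁ x - potential 0 g₂ x := by
  unfold potential
  rw [← integral_sub (integrable_mul_kernel hn le_rfl h₁ hM₁ hs₁ x)
    (integrable_mul_kernel hn le_rfl h₂ hM₂ hs₂ x)]
  refine integral_congr_ae (Eventually.of_forall fun z => ?_)
  simp only [sub_mul]

/-- **Continuity of `N` in the density, sup norms**: if `|g₁ - g₂| ≤ η` everywhere, both bounded,
integrable and supported in `B(c, R)`, then `|N g₁ x - N g₂ x| ≤ C_N η R²`. [folklore] -/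
theorem abs_potential_sub_potential_le (hn : 3 ≤ finrank ℝ E) (h₁ : Integrable g₁)
    (hM₁ : ∀ z, |g₁ z| ≤ M₁) (hs₁ : ∀ z ∉ ball c R, g₁ z = 0) (h₂ : Integrable g₂)
    (hM₂ : ∀ z, |g₂ z| ≤ M₂) (hs₂ : ∀ z ∉ ball c R, g₂ z = 0) (hR : 0 < R) {η : ℝ}
    (hη : ∀ z, |g₁ z - g₂ z| ≤ η) (x : E) :
    |potential 0 g₁ x - potential 0 g₂ x| ≤
      ((finrank ℝ E : ℝ) / 2 + 1) * (volume : Measure E).real (ball 0 1) * (bumpMass E)⁻¹ *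
        η * R ^ 2 := by
  rw [← potential_sub hn h₁ hM₁ hs₁ h₂ hM₂ hs₂ x]
  exact abs_potential_le (g := fun z => g₁ z - g₂ z) (c := c) (R := R) hn le_rfl (h₁.sub h₂) hη
    (fun z hz => by simp only [hs₁ z hz, hs₂ z hz, sub_zero]) hR x

end Linearity

/-! ### Continuity of the Poisson operator in the data, sup norms -/

omit [MeasurableSpace E] [BorelSpace E] in
/-- **`|P ψ₁ - P ψ₂| ≤ η` on `B̄(c, R)` if `|ψ₁ - ψ₂| ≤ η` on the sphere** (both continuous there;
`n ≥ 1`). [folklore] -/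
theorem abs_poisson_sub_poisson_le [MeasurableSpace E] [BorelSpace E] (hn : 0 < finrank ℝ E)
    {c : E} {R : ℝ} (hR : 0 < R) {ψ₁ ψ₂ : E → ℝ} (h₁ : ContinuousOn ψ₁ (sphere c R))
    (h₂ : ContinuousOn ψ₂ (sphere c R)) {η : ℝ} (hη : ∀ ζ ∈ sphere c R, |ψ₁ ζ - ψ₂ ζ| ≤ η) {x : E}
    (hx : x ∈ closedBall c R) : |poisson c R ψ₁ x - poisson c R ψ₂ x| ≤ η := by
  rw [← poisson_sub hR h₁ h₂ x]
  exact abs_poisson_le hn hR (h₁.sub h₂) (fun ζ hζ => hη ζ hζ) hx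

/-! ### Mild functions -/

section Mild

variable {U : Set E} {z : E → ℝ}

/-- **Mild (solutions)**: `z` is positive and continuous on the open set `U`, and near every
point of `U` it is a harmonic function plus the Newtonian potential of a bounded integrable
density, supported in a ball, which equals `f_n(z)` nearby (the shape shared by the fixed points
of the local solver and by limits of Poisson–Newton representations of solutions;
Gilbarg–Trudinger §4.1–4.2). [cite: GilbargTrudinger2001, §4.1–4.2] -/
structure IsMild (U : Set E) (z : E → ℝ) : Prop where
  isOpen : IsOpen U
  continuousOn : ContinuousOn z U
  pos : ∀ x ∈ U, 0 < z x
  rep : ∀ x₀ ∈ U, ∃ s : ℝ, 0 < s ∧ ball x₀ s ⊆ U ∧ ∃ (H g : E → ℝ) (c : E) (R M : ℝ),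
    ContDiffOn ℝ 2 H (ball x₀ s) ∧ (∀ x ∈ ball x₀ s, (Δ H) x = 0) ∧ Integrable g ∧
    (∀ y, |g y| ≤ M) ∧ (∀ y ∉ ball c R, g y = 0) ∧
    (∀ y ∈ ball x₀ s, g y = nonlinearity (finrank ℝ E) (z y)) ∧
    ∀ x ∈ ball x₀ s, z x = H x + potential 0 g x

/-- **Mild functions are `C¹`** (N1). [cite: GilbargTrudinger2001, Lemma 4.1] -/
theorem IsMild.contDiffOn_one (hn : 3 ≤ finrank ℝ E) (h : IsMild U z) : ContDiffOn ℝ 1 z U := by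
  intro x₀ hx₀
  obtain ⟨s, hs, -, H, g, c, R, M, hH, -, hgi, hgM, hgs, -, hrep⟩ := h.rep x₀ hx₀
  have hN : ContDiff ℝ 1 (potential 0 g) := contDiff_one_potential hn hgi hgM hgs
  have h1 : ContDiffOn ℝ 1 (fun x => H x + potential 0 g x) (ball x₀ s) :=
    (hH.of_le (by norm_num)).add hN.contDiffOn
  exact ((h1.congr fun x hx => hrep x hx).contDiffAt
    (isOpen_ball.mem_nhds (mem_ball_self hs))).contDiffWithinAt

/-- **Localisation**: near `x₀ ∈ U` a mild `z` is `H₂ + N[θ f_n(z)]` with a bump `θ` centred at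
`x₀` supported inside `U` and `H₂` harmonic (`(g - θ f_n(z))` vanishes near `x₀`, so its
potential is harmonic there, N4). [cite: GilbargTrudinger2001, §4.1] -/
theorem IsMild.exists_local (hn : 3 ≤ finrank ℝ E) (h : IsMild U z) {x₀ : E} (hx₀ : x₀ ∈ U) :
    ∃ (θ : ContDiffBump x₀) (s t : ℝ), θ.rOut < s ∧ ball x₀ s ⊆ U ∧ 0 < t ∧ t ≤ θ.rIn ∧
      ∃ H₂ : E → ℝ, ContDiffOn ℝ 2 H₂ (ball x₀ t) ∧ (∀ x ∈ ball x₀ t, (Δ H₂) x = 0) ∧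
        ∀ x ∈ ball x₀ t, z x = H₂ x + potential 0 (bumpDensity θ z) x := by
  obtain ⟨s, hs, hsU, H, g, c, R, M, hH, hΔH, hgi, hgM, hgs, hgz, hrep⟩ := h.rep x₀ hx₀
  -- the bump: `= 1` on `B̄(x₀, s/4)`, supported in `B̄(x₀, s/2)`
  let θ : ContDiffBump x₀ := ⟨s / 4, s / 2, by positivity, by linarith⟩
  have hθout : θ.rOut < s := by show s / 2 < s; linarith
  have hθin : θ.rIn = s / 4 := rfl
  -- the two densities
  set g₁ : E → ℝ := bumpDensity θ z with hg₁
  set g₂ : E → ℝ := fun y => g y - g₁ y with hg₂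
  have hθg : ∀ y, g₁ y = θ y * g y := fun y => by
    by_cases hy : y ∈ ball x₀ s
    · rw [hg₁, bumpDensity, hgz y hy]
    · rw [hg₁, bumpDensity_eq_zero θ z hθout y hy]
      have : θ y = 0 := by
        have hy' : y ∉ tsupport (θ : E → ℝ) := fun h' =>
          hy (closedBall_subset_ball hθout (θ.tsupport_eq ▸ h'))
        exact image_eq_zero_of_notMem_tsupport hy'
      rw [this, zero_mul]
  have hg₁M : ∀ y, |g₁ y| ≤ M := fun y => by
    rw [hθg, abs_mul, abs_of_nonneg θ.nonneg]
    exact (mul_le_of_le_one_left (abs_nonneg _) θ.le_one).trans (hgM y)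
  have hg₁s : ∀ y ∉ ball c R, g₁ y = 0 := fun y hy => by rw [hθg, hgs y hy, mul_zero]
  have hg₁i : Integrable g₁ := by
    have : g₁ = fun y => θ y * g y := funext hθg
    rw [this]
    exact hgi.bdd_mul θ.continuous.aestronglyMeasurable
      (Eventually.of_forall fun y => by rw [Real.norm_eq_abs, abs_of_nonneg θ.nonneg]; exact θ.le_one)
  have hg₂M : ∀ y, |g₂ y| ≤ M := fun y => by
    rw [hg₂]; dsimp only
    rw [hθg]
    have : g y - θ y * g y = (1 - θ y) * g y := by ring
    rw [this, abs_mul, abs_of_nonneg (by linarith [θ.le_one (x := y)])]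
    exact (mul_le_of_le_one_left (abs_nonneg _) (by linarith [θ.nonneg (x := y)])).trans (hgM y)
  have hg₂s : ∀ y ∉ ball c R, g₂ y = 0 := fun y hy => by
    simp only [hg₂, hgs y hy, hg₁s y hy, sub_zero]
  have hg₂i : Integrable g₂ := hgi.sub hg₁i
  -- `g₂ = 0` on `B(x₀, s/4)` (where `θ = 1`), so `N g₂` is harmonic on `B(x₀, s/8)` (N4)
  have hg₂0 : ∀ y ∈ ball x₀ (s / 4), g₂ y = 0 := fun y hy => by
    have h1 : θ y = 1 := θ.one_of_mem_closedBall (by rw [hθin]; exact ball_subset_closedBall hy)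
    simp only [hg₂, hθg, h1, one_mul, sub_self]
  obtain ⟨hN₂s, hN₂Δ⟩ := laplacian_potential_eq_zero_of_forall_eq_zero hg₂i hg₂s
    (by positivity : (0 : ℝ) < s / 4) hg₂0
  have h8 : s / 4 / 2 = s / 8 := by ring
  rw [h8] at hN₂s hN₂Δ
  refine ⟨θ, s, s / 8, hθout, hsU, by positivity, by rw [hθin]; linarith, fun x => H x + potential 0 g₂ x,
    ?_, fun x hx => ?_, fun x hx => ?_⟩
  · exact (hH.mono (ball_subset_ball (by linarith))).add (contDiffOn_infty.1 hN₂s 2)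
  · have hxs : x ∈ ball x₀ s := ball_subset_ball (by linarith) hx
    have hHx : ContDiffAt ℝ 2 H x := hH.contDiffAt (isOpen_ball.mem_nhds hxs)
    have hNx : ContDiffAt ℝ 2 (potential 0 g₂) x :=
      (contDiffOn_infty.1 hN₂s 2).contDiffAt (isOpen_ball.mem_nhds hx)
    have : (fun x => H x + potential 0 g₂ x) = H + potential 0 g₂ := rfl
    rw [this, hHx.laplacian_add hNx, hΔH x hxs, hN₂Δ x hx, add_zero]
  · have hxs : x ∈ ball x₀ s := ball_subset_ball (by linarith) hx
    have hsum : potential 0 g x = potential 0 g₁ x + potential 0 g₂ x := by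
      rw [← potential_add hn hg₁i hg₁M hg₁s hg₂i hg₂M hg₂s x]
      congr 1
      funext y
      simp only [hg₂, add_sub_cancel]
    rw [hrep x hxs, hsum]
    ring

/-- **Mild functions are `C²`** (N3 after localisation). [cite: GilbargTrudinger2001, §4.1] -/
theorem IsMild.contDiffOn_two (hn : 3 ≤ finrank ℝ E) (h : IsMild U z) : ContDiffOn ℝ 2 z U := by
  have h1 := h.contDiffOn_one hn
  intro x₀ hx₀
  obtain ⟨θ, s, t, hθs, hsU, ht, -, H₂, hH₂, -, hrep⟩ := h.exists_local hn hx₀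
  have hsub : closedBall x₀ θ.rOut ⊆ U := (closedBall_subset_ball hθs).trans hsU
  have hg1 : ContDiff ℝ 1 (bumpDensity θ z) := contDiff_bumpDensity θ h.isOpen hsub h1 h.pos
  have hts : tsupport (bumpDensity θ z) ⊆ ball x₀ s :=
    (tsupport_bumpDensity_subset θ z).trans (closedBall_subset_ball hθs)
  have hN : ContDiff ℝ 2 (potential 0 (bumpDensity θ z)) := contDiff_two_potential hn hg1 hts
  have h2 : ContDiffOn ℝ 2 (fun x => H₂ x + potential 0 (bumpDensity θ z) x) (ball x₀ t) :=
    hH₂.add hN.contDiffOn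
  exact ((h2.congr fun x hx => hrep x hx).contDiffAt
    (isOpen_ball.mem_nhds (mem_ball_self ht))).contDiffWithinAt

/-- **Mild functions are classical solutions** (`Δ N[θ f_n(z)] = θ f_n(z)`, N2, after
localisation; `n ≥ 3`). [cite: GilbargTrudinger2001, Lemma 4.2] -/
theorem IsMild.isSolution (hn : 3 ≤ finrank ℝ E) (h : IsMild U z) : IsSolution U z where
  contDiffOn := h.contDiffOn_two hn
  nonneg := fun x hx => (h.pos x hx).le
  laplacian_eq := by
    intro x₀ hx₀
    have h2 := h.contDiffOn_two hn
    obtain ⟨θ, s, t, hθs, hsU, ht, htin, H₂, hH₂, hΔH₂, hrep⟩ := h.exists_local hn hx₀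
    have hsub : closedBall x₀ θ.rOut ⊆ U := (closedBall_subset_ball hθs).trans hsU
    have hg2 : ContDiff ℝ 2 (bumpDensity θ z) := contDiff_bumpDensity θ h.isOpen hsub h2 h.pos
    have hts : tsupport (bumpDensity θ z) ⊆ ball x₀ s :=
      (tsupport_bumpDensity_subset θ z).trans (closedBall_subset_ball hθs)
    have hN : ContDiff ℝ 2 (potential 0 (bumpDensity θ z)) :=
      contDiff_two_potential hn (hg2.of_le (by norm_num)) hts
    have hx₀t : x₀ ∈ ball x₀ t := mem_ball_self ht
    have hev : z =ᶠ[𝓝 x₀] (H₂ + potential 0 (bumpDensity θ z)) :=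
      eventuallyEq_of_mem (isOpen_ball.mem_nhds hx₀t) fun x hx => hrep x hx
    rw [(InnerProductSpace.laplacian_congr_nhds hev).eq_of_nhds,
      (hH₂.contDiffAt (isOpen_ball.mem_nhds hx₀t)).laplacian_add hN.contDiffAt, hΔH₂ x₀ hx₀t,
      zero_add, laplacian_potential_eq_self hn hg2 hts x₀,
      bumpDensity_eq_of_mem θ z (mem_closedBall_self θ.rIn_pos.le)]

end Mild

/-! ### The Poisson–Newton representation of a solution on inner balls -/

section Representation

variable {c : E} {r : ℝ} {z : E → ℝ}

/-- **Representation**: let `z` be a solution on `B(c, r)`, positive there, `θ` a bump centred at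
`c` with `r_out < r`, and `0 < ρ ≤ r_in`. Then `h = z - N[θ f_n(z)]` is harmonic on `B(c, ρ)`
(`Δ N[θ f_n(z)] = θ f_n(z) = f_n(z)` there, N2) and continuous on `B̄(c, ρ)`, hence
`h = P_ρ[h]` on `B̄(c, ρ)` (Gilbarg–Trudinger Thm. 2.6). [cite: GilbargTrudinger2001, Thm. 2.6] -/
theorem IsSolution.sub_potential_eq_poisson (hn : 3 ≤ finrank ℝ E) (hz : IsSolution (ball c r) z)
    (hpos : ∀ x ∈ ball c r, 0 < z x) (θ : ContDiffBump c) (hθ : θ.rOut < r) {ρ : ℝ} (hρ : 0 < ρ)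
    (hρin : ρ ≤ θ.rIn) :
    ∀ x ∈ closedBall c ρ, z x - potential 0 (bumpDensity θ z) x =
      poisson c ρ (fun y => z y - potential 0 (bumpDensity θ z) y) x := by
  have hn0 : 0 < finrank ℝ E := by omega
  have hsub : closedBall c θ.rOut ⊆ ball c r := closedBall_subset_ball hθ
  have hg2 : ContDiff ℝ 2 (bumpDensity θ z) := contDiff_bumpDensity θ isOpen_ball hsub hz.contDiffOn hpos
  have hts : tsupport (bumpDensity θ z) ⊆ ball c r := (tsupport_bumpDensity_subset θ z).trans hsub
  have hN : ContDiff ℝ 2 (potential 0 (bumpDensity θ z)) :=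
    contDiff_two_potential hn (hg2.of_le (by norm_num)) hts
  have hρr : closedBall c ρ ⊆ ball c r :=
    (closedBall_subset_closedBall (hρin.trans θ.rIn_lt_rOut.le)).trans hsub
  refine eq_poisson_of_harmonic hn0 hρ ?_ (fun x hx => ?_) fun x hx => ?_
  · exact (hz.contDiffOn.continuousOn.mono hρr).sub hN.continuous.continuousOn
  · exact (hz.contDiffOn.contDiffAt (isOpen_ball.mem_nhds (hρr (ball_subset_closedBall hx)))).sub
      hN.contDiffAt
  · have hxr : x ∈ ball c r := hρr (ball_subset_closedBall hx)
    have hzx : ContDiffAt ℝ 2 z x := hz.contDiffOn.contDiffAt (isOpen_ball.mem_nhds hxr)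
    have : (fun y => z y - potential 0 (bumpDensity θ z) y) = z - potential 0 (bumpDensity θ z) := rfl
    rw [this, hzx.laplacian_sub hN.contDiffAt, hz.laplacian_eq hxr,
      laplacian_potential_eq_self hn hg2 hts x,
      bumpDensity_eq_of_mem θ z (closedBall_subset_closedBall hρin (ball_subset_closedBall hx)),
      sub_self]

end Representation


end LoewnerNirenberg

end Literature.Analysis.PDE
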